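import Summits.Schanuel.Schanuel.Theses.RigidCore
import Summits.Schanuel.Schanuel.Theorems.RoyCriterionRankOne
import Literature.NumberTheory.Transcendental.LindemannWeierstrassProofs
import Literature.NumberTheory.Transcendental.OneMotiveToricProofs
import Literature.Barriers.Schanuel.AlgebraicIndependenceOfLogarithms
import Literature.Barriers.Schanuel.LargeTranscendenceDegree
import Literature.Barriers.Schanuel.LargeTranscendenceDegreeSmallTrdegProofs
import Literature.Barriers.Schanuel.NesterenkoModularScope
import Literature.NumberTheory.Transcendental.PeriodsWave0NesterenkoProofs
import Literature.Barriers.Schanuel.AxSchanuelFunctionalNotNumerical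

/-!
# Disproof of `SchanuelOnLogFreeCore` — findings

Crux `stmt-Schanuel-0970` (route `RigidCore`, decl
`Summit.Schanuel.Schanuel.Theses.RigidCore.SchanuelOnLogFreeCore`): Schanuel's conjecture for
`ℚ`-linearly independent tuples taken from the LOG-FREE CORE
`C_EA = sInf {K : IntermediateField ℚ ℂ | 2πi ∈ K ∧ K exp-closed ∧ K relatively algebraically closed}`.

VERDICT (cycle 1): the statement RESISTS refutation. It is a faithful special case of Schanuel's
conjecture (`crux_of_schanuel`), the `sInf` is a genuine intersection (the family contains `⊤`,
`top_mem_coreFamily`), and every hypothesis is load-bearing or open: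

* (a) LOAD-BEARING. Dropping `LinearIndependent ℚ x` is refuted three ways, all inside the core:
  `x = 0` (`false_without_linIndep`), `x = (2πi, 4πi)` injective and nonzero
  (`false_without_linIndep_injective`), `x = (1, πi, 1 + πi)` pairwise non-proportional
  (`false_without_linIndep_pairwise`). Dropping the core hypothesis gives back the summit
  (`withoutCore_iff_schanuel`) — open, not attackable here. Shrinking the core to `ℚ̄` (drop the
  generator `2πi` and exp-closure) turns the crux into the Lindemann–Weierstrass THEOREM
  (`onAlgebraicNumbers`): the open content enters exactly with `2πi` + `exp`-closure.
* (b) TIGHTNESS. The bound `n` is attained: `x = (2πi)` gives `trdeg = 1` (`tight_at_two_pi_I`),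
  and every algebraic `ℚ`-free tuple gives `trdeg = n` exactly (`trdeg_eq_of_isAlgebraic`).
* (c) NATURAL STRENGTHENINGS REFUTED (all with witnesses in the core): `n + 1 ≤ trdeg`
  (`not_strict`), `2n ≤ trdeg` (`not_double`), `n ≤ trdeg ℚ(e^x)` (`not_expOnly`),
  `n ≤ trdeg ℚ(x)` (`not_logOnly`), "`x` itself algebraically independent" (`not_algIndep_x`,
  witness `(πi, π²)`), "`e^x` algebraically independent" (`not_algIndep_exp`, witness `(1, πi)`),
  and "SC on every single member `K` of the family" is the full summit (`forallMember_iff_schanuel`).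
* (d)/(h) TARGETS: none at arm time; after the pick of line `generic-period-fibre` the residue stubs A
  (SC on the kernel-free core `M`) and B (relative SC of `C_EA` over `M`) satisfy `(R) ↔ A ∧ B`
  (drefuter), so neither is killable short of ¬SC; section (h) records `stubA_of_crux` and
  `transcendental_exp_exp_one_of_stubA` (A ⇒ `e^e` transcendental, OPEN).
* (g) BARRIER, certified: `C_EA ⊆ ecl ∅` (`core_le_eclField`), so every E-derivation of `ℂ_exp`
  vanishes on the core (`eDerivation_apply_eq_zero_of_mem_core`) and Ax's hypothesis fails for every
  core tuple (`not_isQLinearIndependentMod_of_core`): the catalogued barrier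
  `AxSchanuelFunctionalNotNumerical` bites (R) verbatim — no functional-transcendence proof of any
  instance; and the crux is implied by route EclCore's thesis (`crux_of_schanuelOnEcl`).
* (f) SLACK for the planner: the assembly only needs the FIRST-FAILURE form of (R) (extra hypothesis
  `∀ r < n, SchanuelRank r`): `schanuel_of_firstFailureForm`; at rank 2 this changes nothing
  (`firstFailureForm_rank_two_iff`).
* (e) WHY IT RESISTS, as theorems: ranks `0, 1` hold unconditionally (`rank_zero`, `rank_one`,
  Hermite–Lindemann), rank `2` holds on algebraic pairs (LW) and on pairs through `π`
  (`rank_two_through_pi`, Nesterenko), but rank `2` already yields the OPEN algebraic independence of `e` and `π`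
  (`expOnePiAlgebraicIndependent_of_crux`, tree statement `[status: open]`) and the OPEN
  transcendence of `e^{π²}` (`transcendental_exp_pi_sq_of_crux`). A refutation would refute
  Schanuel's conjecture (`crux_of_schanuel`); no counterexample family of the area (branches of
  log, fixed points of exp, Bays–Kirby pseudo-exponential fields) produces tuples violating SC in ℂ.
  COUNTEREXAMPLE SEARCH: any counterexample inside `C_EA` is a finite exponential-algebraic identity
  over `2πi` — the object of Richardson's zero-recognition procedure for elementary/exp-log constants,
  which is correct "unless a counterexample to Schanuel's conjecture" turns up (Richardson, *How to
  recognize zero*, J. Symb. Comput. 24 (1997), doi:10.1006/jsco.1997.0157 — acq-02541, not yet read);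
  none has ever surfaced. Our own PSLQ search at the three open rank-2 instances (`P(e, π) = 0` and
  `P(e, e^e) = 0` of total degree ≤ 6, `e^{π²}` algebraic of degree ≤ 30, `P(π, e^{π²})`, `P(π, cos 1)`;
  `|coeff| ≤ 10⁹`) is compute job `j005132` (item evidence on completion; queued at the time of writing).
-/

noncomputable section

namespace Summit.Schanuel.Schanuel.Cruxes.SchanuelOnLogFreeCore.Disproof

open Summit.Schanuel.Schanuel.Theses.RigidCore
open Complex IntermediateField
open Literature.NumberTheory.Transcendental (transcendental_pi_holds transcendental_exp_holds
  algebraicIndependent_exp_holds transcendental_two_pi_I isAlgebraic_adjoin_over_algebraAdjoin)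
open Literature.Barriers.Schanuel (trdeg_mono trdeg_adjoin_singleton_le_one
  trdeg_adjoin_union_eq_of_isAlgebraic algebraicIndependent_of_le_trdeg_adjoin
  linearIndependent_one_piI isAlgebraic_I algebraicIndependent_real_of_complex
  linearIndependent_pair_of_transcendental)

/-! ## The inlined log-free core -/

/-- The defining family of the log-free core: intermediate fields containing `2πi`, closed under
`exp` and relatively algebraically closed in `ℂ`. [folklore] -/
def coreFamily : Set (IntermediateField ℚ ℂ) :=
  {K : IntermediateField ℚ ℂ | (2 * ↑Real.pi * Complex.I : ℂ) ∈ K ∧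
    (∀ w ∈ K, Complex.exp w ∈ K) ∧ ∀ w : ℂ, IsAlgebraic K w → w ∈ K}

/-- The log-free core `C_EA` exactly as inlined in the crux. [folklore] -/
def core : IntermediateField ℚ ℂ := sInf coreFamily

/-- The Schanuel field `ℚ(x, e^x)` of a tuple. [folklore] -/
abbrev schanuelField {n : ℕ} (x : Fin n → ℂ) : IntermediateField ℚ ℂ :=
  adjoin ℚ (Set.range x ∪ Set.range (Complex.exp ∘ x))

/-- The crux, unfolded against the local names (definitional). [folklore] -/
theorem crux_iff : SchanuelOnLogFreeCore ↔
    ∀ (n : ℕ) (x : Fin n → ℂ), (∀ i, x i ∈ core) → LinearIndependent ℚ x →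
      (n : Cardinal) ≤ Algebra.trdeg ℚ ↥(schanuelField x) :=
  Iff.rfl

/-- The family is not empty: `⊤ = ℂ` belongs to it, so the `sInf` is a genuine intersection and
not the junk value `sInf ∅ = ⊤`. [folklore] -/
theorem top_mem_coreFamily : (⊤ : IntermediateField ℚ ℂ) ∈ coreFamily :=
  ⟨mem_top, fun _ _ => mem_top, fun _ _ => mem_top⟩

theorem mem_core_iff {a : ℂ} : a ∈ core ↔ ∀ K ∈ coreFamily, a ∈ K :=
  IntermediateField.mem_sInf

theorem two_pi_I_mem_core : (2 * ↑Real.pi * Complex.I : ℂ) ∈ core :=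
  mem_core_iff.mpr fun _ hK => hK.1

theorem exp_mem_core {w : ℂ} (hw : w ∈ core) : Complex.exp w ∈ core :=
  mem_core_iff.mpr fun K hK => hK.2.1 w (mem_core_iff.mp hw K hK)

theorem mem_core_of_isAlgebraic {w : ℂ} (hw : IsAlgebraic ℚ w) : w ∈ core :=
  mem_core_iff.mpr fun K hK => hK.2.2 w (hw.isIntegral.tower_top (A := K)).isAlgebraic

theorem I_mem_core : Complex.I ∈ core := mem_core_of_isAlgebraic isAlgebraic_I

theorem ofNat_mem_core (n : ℕ) [n.AtLeastTwo] : (OfNat.ofNat n : ℂ) ∈ core :=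
  mem_core_of_isAlgebraic (isAlgebraic_nat n)

theorem pi_I_mem_core : (↑Real.pi * Complex.I : ℂ) ∈ core := by
  have h := div_mem two_pi_I_mem_core (ofNat_mem_core 2)
  rwa [show (2 * ↑Real.pi * Complex.I : ℂ) / 2 = ↑Real.pi * Complex.I by ring] at h

theorem pi_mem_core : (Real.pi : ℂ) ∈ core := by
  have h := div_mem pi_I_mem_core I_mem_core
  rwa [mul_div_assoc, div_self Complex.I_ne_zero, mul_one] at h

theorem pi_sq_mem_core : ((Real.pi : ℂ)) ^ 2 ∈ core := pow_mem pi_mem_core 2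

theorem exp_one_mem_core : Complex.exp 1 ∈ core := exp_mem_core (one_mem _)

/-! ## Transcendence-degree bookkeeping -/

/-- `trdeg_K K(S) ≤ #S`. [folklore] -/
theorem trdeg_adjoin_le_mk {K E : Type*} [Field K] [Field E] [Algebra K E] (S : Set E) :
    Algebra.trdeg K (adjoin K S) ≤ Cardinal.mk S := by
  haveI := isAlgebraic_adjoin_over_algebraAdjoin (F := K) S
  exact (Algebra.IsAlgebraic.trdeg_le_cardinalMk K (((↑) : adjoin K S → E) ⁻¹' S)).trans
    (Cardinal.mk_preimage_of_injective _ _ Subtype.val_injective)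

/-- `trdeg_K K(a, b) ≤ 2`. [folklore] -/
theorem trdeg_adjoin_pair_le_two {K E : Type*} [Field K] [Field E] [Algebra K E] (a b : E) :
    Algebra.trdeg K (adjoin K ({a, b} : Set E)) ≤ 2 := by
  refine (trdeg_adjoin_le_mk _).trans (Cardinal.mk_insert_le.trans ?_)
  rw [Cardinal.mk_singleton]
  norm_num

/-- An algebraically independent family inside an intermediate field bounds its transcendence
degree from below. [folklore] -/
theorem natCast_le_trdeg_of_algebraicIndependent {n : ℕ} {L : IntermediateField ℚ ℂ}
    (y : Fin n → ℂ) (hy : AlgebraicIndependent ℚ y) (hmem : ∀ i, y i ∈ L) :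
    (n : Cardinal) ≤ Algebra.trdeg ℚ L := by
  let y' : Fin n → L := fun i => ⟨y i, hmem i⟩
  have hy' : AlgebraicIndependent ℚ y' :=
    AlgebraicIndependent.of_comp L.val (by exact hy)
  simpa using hy'.cardinalMk_le_trdeg

/-- A transcendental element forces `trdeg ≥ 1`. [folklore] -/
theorem one_le_trdeg_of_transcendental {L : IntermediateField ℚ ℂ} {w : ℂ} (hw : w ∈ L)
    (ht : Transcendental ℚ w) : (1 : Cardinal) ≤ Algebra.trdeg ℚ L := by
  have h := natCast_le_trdeg_of_algebraicIndependent ![w]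
    (algebraicIndependent_iff_transcendental.mpr (by simpa using ht)) (fun i => by simpa using hw)
  simpa using h

/-- `πi, π²` are `ℚ`-linearly independent (imaginary and real parts). [folklore] -/
theorem linearIndependent_piI_pi_sq :
    LinearIndependent ℚ ![(Real.pi : ℂ) * Complex.I, (Real.pi : ℂ) ^ 2] := by
  rw [LinearIndependent.pair_iff]
  intro s t hst
  have hre := congrArg Complex.re hst
  have him := congrArg Complex.im hst
  simp only [Complex.add_re, Complex.add_im, Complex.smul_re, Complex.smul_im,
    Complex.mul_re, Complex.mul_im, Complex.ofReal_re, Complex.ofReal_im, Complex.I_re,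
    Complex.I_im, Complex.zero_re, Complex.zero_im, mul_zero, mul_one, add_zero,
    zero_add, smul_zero, ← Complex.ofReal_pow, sub_self] at hre him
  refine ⟨?_, ?_⟩
  · rw [Rat.smul_def, mul_eq_zero] at him
    rcases him with h | h
    · exact_mod_cast h
    · exact absurd h Real.pi_ne_zero
  · rw [Rat.smul_def, mul_eq_zero] at hre
    rcases hre with h | h
    · exact_mod_cast h
    · exact absurd h (pow_ne_zero 2 Real.pi_ne_zero)

/-! ## The crux is a special case of the summit -/

/-- `Schanuel → SchanuelOnLogFreeCore` (instantiate). Hence a refutation of the crux refutes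
Schanuel's conjecture. [folklore] -/
theorem crux_of_schanuel (h : _root_.Schanuel) : SchanuelOnLogFreeCore :=
  fun n x _ hli => h n x hli

/-! ## (a) Load-bearing hypotheses -/

/-- The crux with the `ℚ`-linear independence hypothesis DROPPED. -/
def WithoutLinIndep : Prop :=
  ∀ (n : ℕ) (x : Fin n → ℂ), (∀ i, x i ∈ core) →
    (n : Cardinal) ≤ Algebra.trdeg ℚ ↥(schanuelField x)

/-- Any proof must use linear independence: `x = 0 ∈ C_EA` gives `ℚ(0, 1)`, of transcendence
degree `0 < 1`. [folklore] -/
theorem false_without_linIndep : ¬ WithoutLinIndep := by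
  intro h
  have h1 := h 1 (fun _ => 0) (fun _ => zero_mem _)
  haveI : Algebra.IsAlgebraic ℚ ↥(schanuelField (fun _ : Fin 1 => (0 : ℂ))) := by
    refine IntermediateField.isAlgebraic_adjoin (fun z hz => ?_)
    rcases hz with ⟨i, rfl⟩ | ⟨i, rfl⟩
    · exact isIntegral_zero
    · simp only [Function.comp_apply, Complex.exp_zero]; exact isIntegral_one
  rw [trdeg_eq_zero] at h1
  norm_num at h1

/-- The crux with linear independence WEAKENED to "injective and nonzero". -/
def WithoutLinIndepButInjective : Prop :=
  ∀ (n : ℕ) (x : Fin n → ℂ), (∀ i, x i ∈ core) → Function.Injective x → (∀ i, x i ≠ 0) →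
    (n : Cardinal) ≤ Algebra.trdeg ℚ ↥(schanuelField x)

/-- `ℚ(2πi, 4πi, e^{2πi}, e^{4πi}) = ℚ(2πi)` has transcendence degree `≤ 1 < 2`, although
`(2πi, 4πi)` is an injective nonzero tuple of the core: linear independence cannot be weakened to
distinctness. [folklore] -/
theorem false_without_linIndep_injective : ¬ WithoutLinIndepButInjective := by
  intro h
  set c : ℂ := 2 * ↑Real.pi * Complex.I with hc
  have hc0 : c ≠ 0 := by simp [hc, Real.pi_ne_zero, Complex.I_ne_zero]
  let x : Fin 2 → ℂ := ![c, 2 * c]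
  have hx : ∀ i, x i ∈ core := by
    intro i; fin_cases i
    · exact two_pi_I_mem_core
    · exact mul_mem (ofNat_mem_core 2) two_pi_I_mem_core
  have hinj : Function.Injective x := by
    intro i j hij
    fin_cases i <;> fin_cases j
    · rfl
    · exfalso; apply hc0
      have : c = 2 * c := by simpa [x] using hij
      linear_combination -this
    · exfalso; apply hc0
      have : 2 * c = c := by simpa [x] using hij
      linear_combination this
    · rfl
  have hne : ∀ i, x i ≠ 0 := by
    intro i; fin_cases i
    · simpa [x] using hc0
    · simpa [x] using hc0
  have h2 := h 2 x hx hinj hne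
  have hexp1 : Complex.exp c = 1 := by simp [hc]
  have hexp2 : Complex.exp (2 * c) = 1 := by
    rw [two_mul, Complex.exp_add, hexp1, mul_one]
  have hle : schanuelField x ≤ adjoin ℚ {c} := by
    rw [adjoin_le_iff]
    rintro w (⟨i, rfl⟩ | ⟨i, rfl⟩) <;> fin_cases i
    · exact subset_adjoin ℚ _ rfl
    · exact mul_mem (ofNat_mem _ 2) (subset_adjoin ℚ ({c} : Set ℂ) rfl)
    · simp only [Function.comp_apply]; simp [x, hexp1]
    · simp only [Function.comp_apply]; simp [x, hexp2]
  have := (h2.trans (trdeg_mono hle)).trans (trdeg_adjoin_singleton_le_one c)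
  norm_num at this

/-- The crux with linear independence WEAKENED to pairwise independence (no two coordinates
proportional over `ℚ`, all nonzero). -/
def WithoutLinIndepButPairwise : Prop :=
  ∀ (n : ℕ) (x : Fin n → ℂ), (∀ i, x i ∈ core) →
    (∀ i j, i ≠ j → LinearIndependent ℚ ![x i, x j]) →
    (n : Cardinal) ≤ Algebra.trdeg ℚ ↥(schanuelField x)

/-- `x = (1, πi, 1 + πi)`: pairwise `ℚ`-independent core elements, but
`ℚ(x, e^x) = ℚ(1, πi, 1 + πi, e, −1, −e) ⊆ ℚ(πi, e)` has transcendence degree `≤ 2 < 3`. So the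
hypothesis really is the full rank count of Schanuel's conjecture. [folklore] -/
theorem false_without_linIndep_pairwise : ¬ WithoutLinIndepButPairwise := by
  intro h
  set p : ℂ := ↑Real.pi * Complex.I with hp
  let x : Fin 3 → ℂ := ![1, p, 1 + p]
  have hx : ∀ i, x i ∈ core := by
    intro i; fin_cases i
    · exact one_mem _
    · exact pi_I_mem_core
    · exact add_mem (one_mem _) pi_I_mem_core
  -- pairwise independence from the independence of `(1, πi)`
  have h01 : LinearIndependent ℚ ![(1 : ℂ), p] := linearIndependent_one_piI
  have key : ∀ a b c d : ℚ, a * d - b * c ≠ 0 →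
      LinearIndependent ℚ ![a • (1 : ℂ) + b • p, c • (1 : ℂ) + d • p] := by
    intro a b c d hdet
    rw [LinearIndependent.pair_iff] at h01 ⊢
    intro s t hst
    have h' : (s * a + t * c) • (1 : ℂ) + (s * b + t * d) • p = 0 := by
      rw [← hst]; simp only [add_smul, mul_smul, smul_add]; abel
    obtain ⟨h1, h2⟩ := h01 _ _ h'
    constructor
    · have : s * (a * d - b * c) = 0 := by linear_combination d * h1 - c * h2
      exact (mul_eq_zero.mp this).resolve_right hdet
    · have : t * (a * d - b * c) = 0 := by linear_combination a * h2 - b * h1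
      exact (mul_eq_zero.mp this).resolve_right hdet
  have hpair : ∀ i j, i ≠ j → LinearIndependent ℚ ![x i, x j] := by
    intro i j hij
    fin_cases i <;> fin_cases j
    all_goals first
      | exact absurd rfl hij
      | skip
    · simpa [x] using key 1 0 0 1 (by norm_num)
    · simpa [x] using key 1 0 1 1 (by norm_num)
    · simpa [x] using key 0 1 1 0 (by norm_num)
    · simpa [x] using key 0 1 1 1 (by norm_num)
    · simpa [x] using key 1 1 1 0 (by norm_num)
    · simpa [x] using key 1 1 0 1 (by norm_num)
  have h3 := h 3 x hx hpair
  have hexp_p : Complex.exp p = -1 := by simp [hp, Complex.exp_pi_mul_I]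
  have hle : schanuelField x ≤ adjoin ℚ {p, Complex.exp 1} := by
    have hpmem : p ∈ adjoin ℚ ({p, Complex.exp 1} : Set ℂ) := subset_adjoin ℚ _ (by simp)
    have hemem : Complex.exp 1 ∈ adjoin ℚ ({p, Complex.exp 1} : Set ℂ) :=
      subset_adjoin ℚ _ (by simp)
    rw [adjoin_le_iff]
    rintro w (⟨i, rfl⟩ | ⟨i, rfl⟩) <;> fin_cases i
    · exact one_mem _
    · exact hpmem
    · exact add_mem (one_mem _) hpmem
    · simpa [x] using hemem
    · simp only [Function.comp_apply]
      simp [x, hexp_p]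
    · simp only [Function.comp_apply]
      simp [x, Complex.exp_add, hexp_p, hemem]
  have := (h3.trans (trdeg_mono hle)).trans (trdeg_adjoin_pair_le_two p (Complex.exp 1))
  norm_num at this

/-- The crux with the CORE hypothesis dropped. -/
def WithoutCore : Prop :=
  ∀ (n : ℕ) (x : Fin n → ℂ), LinearIndependent ℚ x →
    (n : Cardinal) ≤ Algebra.trdeg ℚ ↥(schanuelField x)

/-- Dropping the core hypothesis gives back the summit verbatim: this weakening is Schanuel's
conjecture itself (open; not attackable by a disprover). [folklore] -/
theorem withoutCore_iff_schanuel : WithoutCore ↔ _root_.Schanuel := Iff.rfl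

/-- SHRINKING the core to `ℚ̄` (dropping the generator `2πi` and the `exp`-closure from the
defining family leaves the relatively algebraically closed subfields, whose intersection is `ℚ̄`)
turns the crux into a THEOREM — Lindemann–Weierstrass: for algebraic `ℚ`-free `x`,
`trdeg ℚ(x, e^x) ≥ n`. So the open content of the crux enters exactly through `2πi` and
`exp`-closure. [cite: Weierstrass1885, via BakerTNT1975 Ch. 1 §3 remark after Theorem 1.4, p. 6] -/
theorem onAlgebraicNumbers (n : ℕ) (x : Fin n → ℂ) (halg : ∀ i, IsAlgebraic ℚ (x i))
    (hli : LinearIndependent ℚ x) : (n : Cardinal) ≤ Algebra.trdeg ℚ ↥(schanuelField x) :=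
  natCast_le_trdeg_of_algebraicIndependent (fun i => Complex.exp (x i))
    (algebraicIndependent_exp_holds x halg hli)
    (fun i => subset_adjoin ℚ _ (Or.inr ⟨i, rfl⟩))

/-! ## (b) Tightness -/

/-- The bound `n` is attained inside the core at `n = 1`: `x = (2πi)`, `ℚ(2πi, 1)` has
transcendence degree exactly `1` (Lindemann for `≥ 1`). [cite: Lindemann1882] -/
theorem tight_at_two_pi_I :
    ∃ x : Fin 1 → ℂ, (∀ i, x i ∈ core) ∧ LinearIndependent ℚ x ∧
      Algebra.trdeg ℚ ↥(schanuelField x) = 1 := by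
  set c : ℂ := 2 * ↑Real.pi * Complex.I with hc
  have hc0 : c ≠ 0 := by simp [hc, Real.pi_ne_zero, Complex.I_ne_zero]
  refine ⟨![c], fun i => by simpa using two_pi_I_mem_core, ?_, le_antisymm ?_ ?_⟩
  · exact linearIndependent_unique_iff.mpr (by simpa using hc0)
  · have hle : schanuelField ![c] ≤ adjoin ℚ {c} := by
      rw [adjoin_le_iff]
      rintro w (⟨i, rfl⟩ | ⟨i, rfl⟩) <;> fin_cases i
      · exact subset_adjoin ℚ _ rfl
      · simp only [Function.comp_apply]; simp [hc]
    exact (trdeg_mono hle).trans (trdeg_adjoin_singleton_le_one c)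
  · exact one_le_trdeg_of_transcendental (subset_adjoin ℚ _ (Or.inl ⟨0, rfl⟩))
      (by simpa [hc] using transcendental_two_pi_I)

/-- The bound is attained on EVERY algebraic `ℚ`-free tuple: `trdeg ℚ(x, e^x) = n` exactly
(`≥`: Lindemann–Weierstrass; `≤`: the `x i` are algebraic and there are `n` exponentials).
[cite: Weierstrass1885, via BakerTNT1975 Ch. 1 §3 remark after Theorem 1.4, p. 6] -/
theorem trdeg_eq_of_isAlgebraic (n : ℕ) (x : Fin n → ℂ) (halg : ∀ i, IsAlgebraic ℚ (x i))
    (hli : LinearIndependent ℚ x) : Algebra.trdeg ℚ ↥(schanuelField x) = n := by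
  refine le_antisymm ?_ (onAlgebraicNumbers n x halg hli)
  have heq : Algebra.trdeg ℚ ↥(schanuelField x) =
      Algebra.trdeg ℚ ↥(adjoin ℚ (Set.range (Complex.exp ∘ x))) := by
    rw [schanuelField, Set.union_comm]
    exact trdeg_adjoin_union_eq_of_isAlgebraic _ _ (by rintro _ ⟨i, rfl⟩; exact halg i)
  rw [heq]
  refine (trdeg_adjoin_le_mk _).trans ?_
  simpa using Cardinal.mk_range_le (f := Complex.exp ∘ x)

/-! ## (c) Natural strengthenings, refuted inside the core -/

/-- Strengthening the conclusion to `n + 1 ≤ trdeg` fails at `x = (2πi)`. [folklore] -/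
theorem not_strict : ¬ ∀ (n : ℕ) (x : Fin n → ℂ), (∀ i, x i ∈ core) → LinearIndependent ℚ x →
    ((n + 1 : ℕ) : Cardinal) ≤ Algebra.trdeg ℚ ↥(schanuelField x) := by
  intro h
  obtain ⟨x, hx, hli, h1⟩ := tight_at_two_pi_I
  have := h 1 x hx hli
  rw [h1] at this
  norm_num at this

/-- Strengthening the conclusion to full independence `2n ≤ trdeg` (all of `x, e^x` independent)
fails at `x = (2πi)`. [folklore] -/
theorem not_double : ¬ ∀ (n : ℕ) (x : Fin n → ℂ), (∀ i, x i ∈ core) → LinearIndependent ℚ x →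
    ((2 * n : ℕ) : Cardinal) ≤ Algebra.trdeg ℚ ↥(schanuelField x) := by
  intro h
  obtain ⟨x, hx, hli, h1⟩ := tight_at_two_pi_I
  have := h 1 x hx hli
  rw [h1] at this
  norm_num at this

/-- The Lindemann–Weierstrass SHAPE `n ≤ trdeg ℚ(e^x)` (exponentials alone) fails on the core:
`x = (2πi)`, `e^x = 1`. [folklore] -/
theorem not_expOnly : ¬ ∀ (n : ℕ) (x : Fin n → ℂ), (∀ i, x i ∈ core) → LinearIndependent ℚ x →
    (n : Cardinal) ≤ Algebra.trdeg ℚ ↥(adjoin ℚ (Set.range (Complex.exp ∘ x))) := by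
  intro h
  set c : ℂ := 2 * ↑Real.pi * Complex.I with hc
  have hc0 : c ≠ 0 := by simp [hc, Real.pi_ne_zero, Complex.I_ne_zero]
  have h1 := h 1 ![c] (fun i => by simpa using two_pi_I_mem_core)
    (linearIndependent_unique_iff.mpr (by simpa using hc0))
  haveI : Algebra.IsAlgebraic ℚ ↥(adjoin ℚ (Set.range (Complex.exp ∘ ![c]))) := by
    refine IntermediateField.isAlgebraic_adjoin (fun z hz => ?_)
    obtain ⟨i, rfl⟩ := hz
    fin_cases i
    simp only [Function.comp_apply]
    simp [hc, isIntegral_one]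
  rw [trdeg_eq_zero] at h1
  norm_num at h1

/-- The algebraic-independence-of-logarithms SHAPE `n ≤ trdeg ℚ(x)` (arguments alone) fails on
the core: `x = (1)`. [folklore] -/
theorem not_logOnly : ¬ ∀ (n : ℕ) (x : Fin n → ℂ), (∀ i, x i ∈ core) → LinearIndependent ℚ x →
    (n : Cardinal) ≤ Algebra.trdeg ℚ ↥(adjoin ℚ (Set.range x)) := by
  intro h
  have h1 := h 1 ![1] (fun i => by fin_cases i; exact one_mem _)
    (linearIndependent_unique_iff.mpr (by simp))
  haveI : Algebra.IsAlgebraic ℚ ↥(adjoin ℚ (Set.range ![(1 : ℂ)])) := by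
    refine IntermediateField.isAlgebraic_adjoin (fun z hz => ?_)
    obtain ⟨i, rfl⟩ := hz
    fin_cases i
    simpa using isIntegral_one
  rw [trdeg_eq_zero] at h1
  norm_num at h1

/-- On the core, `ℚ`-linear independence does NOT give algebraic independence of `x` itself
(contrast `AlgIndepLogarithms`, where the `x i` are logarithms of algebraic numbers): `(πi, π²)` is
`ℚ`-free but `(πi)² + π² = 0`. [folklore] -/
theorem not_algIndep_x : ¬ ∀ (n : ℕ) (x : Fin n → ℂ), (∀ i, x i ∈ core) → LinearIndependent ℚ x →
    AlgebraicIndependent ℚ x := by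
  intro h
  set p : ℂ := ↑Real.pi * Complex.I with hp
  have hx : ∀ i, (![p, (Real.pi : ℂ) ^ 2]) i ∈ core := by
    intro i; fin_cases i
    · exact pi_I_mem_core
    · exact pi_sq_mem_core
  have hli : LinearIndependent ℚ ![p, (Real.pi : ℂ) ^ 2] := by
    simpa [hp] using linearIndependent_piI_pi_sq
  have hai := h 2 _ hx hli
  -- the relation X₀² + X₁ = 0
  have := hai.eq_zero_of_aeval_eq_zero (MvPolynomial.X 0 ^ 2 + MvPolynomial.X 1) (by
    simp only [map_add, map_pow, MvPolynomial.aeval_X, Matrix.cons_val_zero, Matrix.cons_val_one,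
      hp]
    rw [mul_pow, Complex.I_sq]; ring)
  have h1 := congrArg (MvPolynomial.eval ![(0 : ℚ), 1]) this
  simp at h1

/-- Nor does it give algebraic independence of the exponentials (contrast Lindemann–Weierstrass,
where the `x i` are algebraic): `(1, πi)` is `ℚ`-free in the core but `e^{πi} = −1`. [folklore] -/
theorem not_algIndep_exp : ¬ ∀ (n : ℕ) (x : Fin n → ℂ), (∀ i, x i ∈ core) →
    LinearIndependent ℚ x → AlgebraicIndependent ℚ (Complex.exp ∘ x) := by
  intro h
  have hx : ∀ i, (![(1 : ℂ), ↑Real.pi * Complex.I]) i ∈ core := by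
    intro i; fin_cases i
    · exact one_mem _
    · exact pi_I_mem_core
  have hai := h 2 _ hx linearIndependent_one_piI
  have := hai.eq_zero_of_aeval_eq_zero (MvPolynomial.X 1 + 1) (by
    simp [Complex.exp_pi_mul_I])
  have h1 := congrArg (MvPolynomial.coeff 0) this
  simp at h1

/-- Replacing the intersection `C_EA` by "every single member `K` of the defining family" is
the FULL summit (the family contains `⊤ = ℂ`): the `sInf` is what makes the crux a proper
sub-conjecture. [folklore] -/
theorem forallMember_iff_schanuel :
    (∀ K ∈ coreFamily, ∀ (n : ℕ) (x : Fin n → ℂ), (∀ i, x i ∈ K) → LinearIndependent ℚ x →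
      (n : Cardinal) ≤ Algebra.trdeg ℚ ↥(schanuelField x)) ↔ _root_.Schanuel :=
  ⟨fun h n x hli => h ⊤ top_mem_coreFamily n x (fun _ => mem_top) hli,
    fun h _ _ n x _ hli => h n x hli⟩

/-! ## (d) Targets — none this cycle (`payload.stuck_stubs = []`) -/

/-! ## (e) Why it resists: small ranks hold, rank 2 is already open -/

/-- Rank `0` of the crux (indeed of Schanuel) is trivial. [folklore] -/
theorem rank_zero (x : Fin 0 → ℂ) : ((0 : ℕ) : Cardinal) ≤ Algebra.trdeg ℚ ↥(schanuelField x) := by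
  simp

/-- Rank `1` of the crux holds unconditionally and WITHOUT the core hypothesis
(Hermite–Lindemann, tree `transcendental_exp_holds` + `schanuelRank_one_of_transcendental_exp`):
the first open rank is `2`. [cite: Lindemann1882, via BakerTNT1975 Ch. 1 §3 Theorem 1.4, p. 6] -/
theorem rank_one (x : Fin 1 → ℂ) (hli : LinearIndependent ℚ x) :
    ((1 : ℕ) : Cardinal) ≤ Algebra.trdeg ℚ ↥(schanuelField x) :=
  Literature.Transcend.schanuelRank_one_of_transcendental_exp transcendental_exp_holds x hli

/-- The crux restricted to ranks `≤ 1` is a theorem. [folklore] -/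
theorem crux_rank_le_one (n : ℕ) (hn : n ≤ 1) (x : Fin n → ℂ) (hli : LinearIndependent ℚ x) :
    (n : Cardinal) ≤ Algebra.trdeg ℚ ↥(schanuelField x) := by
  interval_cases n
  · exact rank_zero x
  · exact rank_one x hli

/-- **Rank `2` of the crux at every pair through `π` is Nesterenko's theorem** (tree
`nesterenko_holds`: `π, e^π, Γ(1/4)` algebraically independent): `ℚ(π, x₁, e^π, e^{x₁}) ⊇ ℚ(π, e^π)`
has transcendence degree `≥ 2`, with NO core or independence hypothesis. So inside the core at
rank `2` the proved instances are: algebraic pairs (Lindemann–Weierstrass, `onAlgebraicNumbers`)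
and pairs through `π` (this theorem, e.g. `(π, 1)`, `(π, πi)`); whereas `(1, πi)` (`e ⊥ π`),
`(πi, π²)` (`e^{π²} ∉ ℚ̄`), `(1, e)` (`e ⊥ e^e`) are open — note `(π, 1)` is proved but `(πi, 1)`
is not. [cite: NesterenkoPhilippon2001, Ch. 3 §1 Theorem 1.1 and Corollary 1.2 (p. 27, PDF p. 39)] -/
theorem rank_two_through_pi (x : Fin 2 → ℂ) (h0 : x 0 = Real.pi) :
    ((2 : ℕ) : Cardinal) ≤ Algebra.trdeg ℚ ↥(schanuelField x) := by
  have hN := Literature.NumberTheory.Transcendental.nesterenko_holds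
  have hsub : AlgebraicIndependent ℚ ![Real.pi, Real.exp Real.pi] := by
    have h := hN.comp ![(0 : Fin 3), 1] (by decide)
    convert h using 1
    funext i; fin_cases i <;> simp
  have h2 : AlgebraicIndependent ℚ ![(Real.pi : ℂ), ((Real.exp Real.pi : ℝ) : ℂ)] := by
    have h := hsub.map' (f := (algebraMap ℝ ℂ).toRatAlgHom) (algebraMap ℝ ℂ).injective
    convert h using 1
    funext i; fin_cases i <;> simp [RingHom.toRatAlgHom_apply]
  refine natCast_le_trdeg_of_algebraicIndependent _ h2 (fun i => ?_)
  fin_cases i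
  · have hm : x 0 ∈ schanuelField x := subset_adjoin ℚ _ (Or.inl ⟨0, rfl⟩)
    simpa [h0] using hm
  · have hm : Complex.exp (x 0) ∈ schanuelField x := subset_adjoin ℚ _ (Or.inr ⟨0, rfl⟩)
    simpa [h0, Complex.ofReal_exp] using hm

/-- **The crux implies the algebraic independence of `e` and `π`** (tree statement
`Literature.NumberTheory.Transcendental.ExpOnePiAlgebraicIndependent`, `[status: open]`,
"considered out of reach" [Bays–Kirby 2018 §1]): `x = (1, πi)` lies in the core, is `ℚ`-free, and
`ℚ(1, πi, e, −1) ⊆ ℚ(e, π)(i)`. This is why no prover is expected to close rank `2`, and why no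
disproof is expected either. [cite: BaysKirby2018ANT, §1.1] -/
theorem expOnePiAlgebraicIndependent_of_crux (hR : SchanuelOnLogFreeCore) :
    Literature.NumberTheory.Transcendental.ExpOnePiAlgebraicIndependent := by
  have hx : ∀ i, (![(1 : ℂ), ↑Real.pi * Complex.I]) i ∈ core := by
    intro i; fin_cases i
    · exact one_mem _
    · exact pi_I_mem_core
  have h2 := hR 2 _ hx linearIndependent_one_piI
  set l : Fin 2 → ℂ := fun i => ((![Real.exp 1, Real.pi] i : ℝ) : ℂ) with hldef
  have he : Complex.exp 1 ∈ adjoin ℚ (Set.range l ∪ {Complex.I}) := by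
    refine subset_adjoin ℚ _ (Or.inl ⟨0, ?_⟩)
    simp [hldef, Complex.ofReal_exp]
  have hpi : (Real.pi : ℂ) ∈ adjoin ℚ (Set.range l ∪ {Complex.I}) :=
    subset_adjoin ℚ _ (Or.inl ⟨1, by simp [hldef]⟩)
  have hI : Complex.I ∈ adjoin ℚ (Set.range l ∪ {Complex.I}) := subset_adjoin ℚ _ (Or.inr rfl)
  have hle : schanuelField ![(1 : ℂ), ↑Real.pi * Complex.I] ≤ adjoin ℚ (Set.range l ∪ {Complex.I}) := by
    rw [adjoin_le_iff]
    rintro w (⟨i, rfl⟩ | ⟨i, rfl⟩) <;> fin_cases i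
    · exact one_mem _
    · exact mul_mem hpi hI
    · simpa using he
    · simp [Complex.exp_pi_mul_I]
  have h2' : ((2 : ℕ) : Cardinal) ≤ Algebra.trdeg ℚ (adjoin ℚ (Set.range l)) := by
    refine (h2.trans (trdeg_mono hle)).trans_eq ?_
    exact trdeg_adjoin_union_eq_of_isAlgebraic _ _
      (fun w hw => by rw [Set.mem_singleton_iff.mp hw]; exact isAlgebraic_I)
  exact algebraicIndependent_real_of_complex _ (algebraicIndependent_of_le_trdeg_adjoin l h2')

/-- **The crux implies the transcendence of `e^{π²}`** (printed as open: Waldschmidt 2005 §8.1,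
Exemple 26): `x = (πi, π²)` lies in the core and is `ℚ`-free; if `e^{π²}` were algebraic then
`ℚ(πi, π², −1, e^{π²}) ⊆ ℚ(πi)(algebraic elements)` would have transcendence degree `≤ 1 < 2`.
[cite: Waldschmidt2005Periodes, §8.1 Exemple 26] -/
theorem transcendental_exp_pi_sq_of_crux (hR : SchanuelOnLogFreeCore) :
    Transcendental ℚ (Complex.exp ((Real.pi : ℂ) ^ 2)) := by
  intro halg
  set p : ℂ := ↑Real.pi * Complex.I with hp
  have hx : ∀ i, (![p, (Real.pi : ℂ) ^ 2]) i ∈ core := by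
    intro i; fin_cases i
    · exact pi_I_mem_core
    · exact pi_sq_mem_core
  have hli : LinearIndependent ℚ ![p, (Real.pi : ℂ) ^ 2] := by
    simpa [hp] using linearIndependent_piI_pi_sq
  have h2 := hR 2 _ hx hli
  have hpsq : (Real.pi : ℂ) ^ 2 = -p ^ 2 := by rw [hp, mul_pow, Complex.I_sq]; ring
  have hexp_p : Complex.exp p = -1 := by simp [hp, Complex.exp_pi_mul_I]
  -- `ℚ(x, e^x) ≤ ℚ({p} ∪ {e^{π²}})`
  have hle : schanuelField ![p, (Real.pi : ℂ) ^ 2] ≤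
      adjoin ℚ ({p} ∪ {Complex.exp ((Real.pi : ℂ) ^ 2)}) := by
    have hpmem : p ∈ adjoin ℚ (({p} ∪ {Complex.exp ((Real.pi : ℂ) ^ 2)}) : Set ℂ) :=
      subset_adjoin ℚ _ (Or.inl rfl)
    rw [adjoin_le_iff]
    rintro w (⟨i, rfl⟩ | ⟨i, rfl⟩) <;> fin_cases i
    · exact hpmem
    · have hsq := neg_mem (pow_mem hpmem 2)
      rw [← hpsq] at hsq
      simpa using hsq
    · simp only [Function.comp_apply]
      simp [hexp_p]
    · exact subset_adjoin ℚ _ (Or.inr rfl)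
  have := (h2.trans (trdeg_mono hle)).trans
    ((trdeg_adjoin_union_eq_of_isAlgebraic _ _ (fun w hw => by
      rw [Set.mem_singleton_iff.mp hw]; exact halg)).trans_le (trdeg_adjoin_singleton_le_one p))
  norm_num at this

/-! ## (f) Slack: the route only needs the first-failure form of the crux -/

/-- The FIRST-FAILURE form of the crux: Schanuel on core tuples of rank `n` ASSUMING Schanuel in
all ranks `r < n`. Implied by the crux (`firstFailureForm_of_crux`) and still sufficient for the
route's deciding theorem (`schanuel_of_firstFailureForm`), because the assembly only ever applies
(R) to a first-failure counterexample. At `n = 2` the extra hypothesis is free (ranks `0, 1` are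
theorems), so the open content (`e ⊥ π`) is unchanged; from `n = 3` on it is a genuine weakening of
what a prover of (R) must show. (Planner information; the disprover reshapes nothing.) -/
def FirstFailureForm : Prop :=
  ∀ (n : ℕ) (x : Fin n → ℂ), (∀ i, x i ∈ core) → LinearIndependent ℚ x →
    (∀ r < n, Literature.NumberTheory.Transcendental.SchanuelRank r) →
    (n : Cardinal) ≤ Algebra.trdeg ℚ ↥(schanuelField x)

/-- (R) implies its first-failure form. [folklore] -/
theorem firstFailureForm_of_crux (hR : SchanuelOnLogFreeCore) : FirstFailureForm :=
  fun n x hx hli _ => hR n x hx hli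

/-- The route's assembly goes through with the first-failure form in place of (R) (same strong
induction as `Summit.Schanuel.Schanuel.Theses.RigidCore.closes`). [folklore] -/
theorem schanuel_of_firstFailureForm (hS : MinimalCounterexampleInAcl) (hA : AclSubsetLogFreeCore)
    (hR' : FirstFailureForm) : _root_.Schanuel := by
  show ∀ (n : ℕ) (z : Fin n → ℂ), LinearIndependent ℚ z →
    (n : Cardinal) ≤ Algebra.trdeg ℚ
      ↥(IntermediateField.adjoin ℚ (Set.range z ∪ Set.range (Complex.exp ∘ z)))
  intro n
  induction n using Nat.strong_induction_on with
  | _ n ih =>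
    intro z hz
    by_contra hlt
    have hlt' : Algebra.trdeg ℚ
        ↥(IntermediateField.adjoin ℚ (Set.range z ∪ Set.range (Complex.exp ∘ z))) <
          (n : Cardinal) := lt_of_not_ge hlt
    have hrank : ∀ r < n, Literature.NumberTheory.Transcendental.SchanuelRank r :=
      fun r hr => ih r hr
    have hmem : ∀ i, z i ∈ core := fun i => hA (z i) (hS n z hz hlt' hrank i)
    exact hlt (hR' n z hmem hz hrank)

/-- At rank `2` the first-failure form IS the crux at rank `2` (ranks `0, 1` are theorems), so the
weakening does not remove `e ⊥ π`. [folklore] -/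
theorem firstFailureForm_rank_two_iff :
    (∀ (x : Fin 2 → ℂ), (∀ i, x i ∈ core) → LinearIndependent ℚ x →
      (∀ r < 2, Literature.NumberTheory.Transcendental.SchanuelRank r) →
      ((2 : ℕ) : Cardinal) ≤ Algebra.trdeg ℚ ↥(schanuelField x)) ↔
    (∀ (x : Fin 2 → ℂ), (∀ i, x i ∈ core) → LinearIndependent ℚ x →
      ((2 : ℕ) : Cardinal) ≤ Algebra.trdeg ℚ ↥(schanuelField x)) := by
  have hranks : ∀ r < 2, Literature.NumberTheory.Transcendental.SchanuelRank r := by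
    intro r hr
    interval_cases r
    · exact Literature.NumberTheory.Transcendental.schanuelRank_zero
    · exact Literature.Transcend.schanuelRank_one_of_transcendental_exp transcendental_exp_holds
  exact ⟨fun h x hx hli => h x hx hli hranks, fun h x hx hli _ => h x hx hli⟩

/-! ## (g) The functional barrier bites the crux verbatim: `C_EA ⊆ ecl ∅` -/

/-- Kirby's exponential-algebraic closure `ecl ∅ ⊆ ℂ` as an intermediate field (carrier of the
tree's `Khovanskii.eclSubfield ∅`). [cite: Kirby2010, Lemma 3.3] -/
def eclField : IntermediateField ℚ ℂ :=
  (Literature.NumberTheory.Transcendental.Khovanskii.eclSubfield (∅ : Set ℂ)).toIntermediateField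
    (fun q => by
      rw [eq_ratCast]
      exact Literature.Barriers.Schanuel.ratCast_mem_ecl ∅ q)

/-- Membership in `eclField` is membership in `ecl ∅`. [cite: Kirby2010, Lemma 3.3] -/
theorem mem_eclField_iff {a : ℂ} :
    a ∈ eclField ↔ a ∈ Literature.NumberTheory.Transcendental.ecl (∅ : Set ℂ) :=
  Iff.rfl

/-- `ecl ∅` belongs to the defining family of the core: it contains `2πi = 2·πi`, is closed under
`exp` (Kirby Lemma 3.3) and is relatively algebraically closed in `ℂ` (Kirby §7, tree
`Khovanskii.mem_ecl_of_isRoot`). [cite: Kirby2010, Lemma 3.3 and §7 (proof of Prop. 7.1)] -/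
theorem eclField_mem_coreFamily : eclField ∈ coreFamily := by
  refine ⟨?_, ?_, ?_⟩
  · have h := Literature.NumberTheory.Transcendental.Khovanskii.mul_mem_ecl
      (Literature.Barriers.Schanuel.mem_ecl_of_isAlgebraic (∅ : Set ℂ) (isAlgebraic_nat 2))
      (Literature.Barriers.Schanuel.pi_mul_I_mem_ecl ∅)
    rw [mem_eclField_iff]
    convert h using 1
    push_cast
    ring
  · intro w hw
    exact Literature.NumberTheory.Transcendental.Khovanskii.exp_mem_ecl hw
  · intro w hw
    obtain ⟨p, hp0, hpw⟩ := hw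
    refine Literature.NumberTheory.Transcendental.Khovanskii.mem_ecl_of_isRoot
      (p := p.map (algebraMap eclField ℂ)) ?_ ?_ ?_
    · exact (Polynomial.map_ne_zero_iff (algebraMap eclField ℂ).injective).mpr hp0
    · intro n
      rw [Polynomial.coeff_map]
      exact (p.coeff n).2
    · rw [Polynomial.IsRoot, Polynomial.eval_map, ← Polynomial.aeval_def, hpw]

/-- `C_EA ⊆ ecl ∅`: every element of the log-free core is exponentially algebraic.
[cite: Kirby2010, Lemma 3.3 and §7 (proof of Prop. 7.1)] -/
theorem core_le_eclField : core ≤ eclField := sInf_le eclField_mem_coreFamily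

/-- **The barrier `AxSchanuelFunctionalNotNumerical` applies to (R) verbatim**: every
E-derivation of `ℂ_exp` vanishes identically on the core (Kirby Prop. 4.7 via `C_EA ⊆ ecl ∅`), so
Ax–Schanuel-type (functional transcendence / derivation) input proves NO instance of the crux —
the route's claim "every symmetric method is void here" holds at least for the functional ones.
[cite: Kirby2010, Prop. 4.7] -/
theorem eDerivation_apply_eq_zero_of_mem_core {D : Derivation ℤ ℂ ℂ}
    (hD : Literature.NumberTheory.Transcendental.IsEDerivation D) {a : ℂ} (ha : a ∈ core) :
    D a = 0 :=
  Literature.Barriers.Schanuel.eDerivation_apply_eq_zero_of_mem_ecl_empty hD (core_le_eclField ha)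

/-- Hence Ax's hypothesis ("`ℚ`-linearly independent modulo the constants of a finite family of
E-derivations") FAILS for every core tuple of positive length. [cite: Kirby2010, Prop. 4.7 and Thm. 5.1] -/
theorem not_isQLinearIndependentMod_of_core {m n : ℕ} (D : Fin m → Derivation ℤ ℂ ℂ)
    (hD : ∀ j, Literature.NumberTheory.Transcendental.IsEDerivation (D j)) {x : Fin n → ℂ}
    (i₀ : Fin n) (hx : x i₀ ∈ core) :
    ¬ Literature.NumberTheory.Transcendental.IsQLinearIndependentMod D x :=
  Literature.Barriers.Schanuel.not_isQLinearIndependentMod_of_mem_ecl_empty D hD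
    (i₀ := i₀) (core_le_eclField hx)

/-- The crux sits BELOW the thesis of the closed route `EclCore` (Schanuel on `ecl ∅`, which is
`↔ Schanuel` by Kirby's Prop. 7.2, tree `schanuelConjecture_iff_ecl_empty_holds`): SC on `ecl ∅`
implies SC on `C_EA ⊆ ecl ∅`. No converse is known. [cite: Kirby2010, Prop. 7.2] -/
theorem crux_of_schanuelOnEcl
    (h : ∀ (n : ℕ) (x : Fin n → ℂ),
      (∀ i, x i ∈ Literature.NumberTheory.Transcendental.ecl (∅ : Set ℂ)) → LinearIndependent ℚ x →
      (n : Cardinal) ≤ Algebra.trdeg ℚ ↥(schanuelField x)) :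
    SchanuelOnLogFreeCore :=
  fun n x hx hli => h n x (fun i => core_le_eclField (hx i)) hli

/-! ## (h) Targets after the pick (line `generic-period-fibre`, PICKED 2026-08-16T02:40Z)

The lead's residue stubs are A = Schanuel on the KERNEL-FREE core `M = sInf {K | exp-closed ∧ r.a.c.}`
(`stub_schanuelOnKernelFreeCore`) and B = relative Schanuel of `C_EA` over `M`
(`stub_periodGenericOverCore`), with `(R) ↔ A ∧ B` kernel-checked by the drefuter (`SplitExact.lean`,
`DrefuteGPF.crux_iff_stubA_and_stubB`). Consequently NEITHER target is killable by a disprover short of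
refuting Schanuel's conjecture: `A` is the restriction of (R) along `M ≤ C_EA` (`stubA_of_crux` below),
`B` follows from (R) (drefuter), and (R) follows from SC (`crux_of_schanuel`). Both are open from rank 2
(A ∋ `e ⊥ e^e` at `x = (1, e)`; B ∋ `π ⊥_M e^{-4π²}` at `(2πi, -4π²)`); see the drefuter's report
`Cruxes/SchanuelOnLogFreeCore/DrefuteStubsGenericPeriodFibre.md` (mutations of A and B: the same
load-bearing pattern as (a) above). No `_false` theorem is to be expected for A or B. -/

/-- The kernel-free core `M = ℚ^{EA} ∩ ℂ` (verbatim the stubs' set-builder). [folklore] -/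
def kernelFreeCore : IntermediateField ℚ ℂ :=
  sInf {K : IntermediateField ℚ ℂ | (∀ w ∈ K, Complex.exp w ∈ K) ∧ ∀ w : ℂ, IsAlgebraic K w → w ∈ K}

/-- `M ≤ C_EA` (every member of the core's family is a member of `M`'s family). [folklore] -/
theorem kernelFreeCore_le_core : kernelFreeCore ≤ core :=
  sInf_le_sInf fun _ hK => hK.2

/-- Target A is a CONSEQUENCE of the crux (restriction along `M ≤ C_EA`), hence of SC: not a
disprover's kill. [folklore] -/
theorem stubA_of_crux (hR : SchanuelOnLogFreeCore) :
    ∀ (n : ℕ) (x : Fin n → ℂ), (∀ i, x i ∈ kernelFreeCore) → LinearIndependent ℚ x →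
      (n : Cardinal) ≤ Algebra.trdeg ℚ ↥(schanuelField x) :=
  fun n x hx hli => hR n x (fun i => kernelFreeCore_le_core (hx i)) hli

/-- Target A at its first open instance: A forces the transcendence of `e^e` (OPEN — not even the
irrationality of `e^e` is known; Schneider's eighth problem / Brownawell–Waldschmidt give only "one of
`e^e`, `e^{e²}` is transcendental"): `x = (1, e) ∈ M²` is `ℚ`-free and `ℚ(1, e, e, e^e) = ℚ(e)(e^e)`.
So A, like (R), is out of reach of every catalogued engine. [cite: BakerTNT1975, Ch. 12 §1, Theorem 12.2 and the following paragraph, p. 111] -/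
theorem transcendental_exp_exp_one_of_stubA
    (hA : ∀ (n : ℕ) (x : Fin n → ℂ), (∀ i, x i ∈ kernelFreeCore) → LinearIndependent ℚ x →
      (n : Cardinal) ≤ Algebra.trdeg ℚ ↥(schanuelField x)) :
    Transcendental ℚ (Complex.exp (Complex.exp 1)) := by
  intro halg
  have he : Complex.exp 1 ∈ kernelFreeCore := by
    rw [kernelFreeCore, IntermediateField.mem_sInf]
    exact fun K hK => hK.1 1 (one_mem K)
  have hx : ∀ i, (![(1 : ℂ), Complex.exp 1]) i ∈ kernelFreeCore := by
    intro i; fin_cases i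
    · exact one_mem _
    · exact he
  have het : Transcendental ℚ (Complex.exp 1) :=
    Literature.NumberTheory.Transcendental.transcendental_rat_cexp_one
  have hli : LinearIndependent ℚ ![(1 : ℂ), Complex.exp 1] :=
    (linearIndependent_pair_of_transcendental het).2
  have h2 := hA 2 _ hx hli
  have hle : schanuelField ![(1 : ℂ), Complex.exp 1] ≤
      adjoin ℚ ({Complex.exp 1} ∪ {Complex.exp (Complex.exp 1)}) := by
    rw [adjoin_le_iff]
    rintro w (⟨i, rfl⟩ | ⟨i, rfl⟩) <;> fin_cases i
    · exact one_mem _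
    · exact subset_adjoin ℚ _ (Or.inl rfl)
    · simpa using (subset_adjoin ℚ _ (Or.inl rfl) :
        Complex.exp 1 ∈ adjoin ℚ (({Complex.exp 1} ∪ {Complex.exp (Complex.exp 1)}) : Set ℂ))
    · simpa using (subset_adjoin ℚ _ (Or.inr rfl) :
        Complex.exp (Complex.exp 1) ∈
          adjoin ℚ (({Complex.exp 1} ∪ {Complex.exp (Complex.exp 1)}) : Set ℂ))
  have := (h2.trans (trdeg_mono hle)).trans
    ((trdeg_adjoin_union_eq_of_isAlgebraic _ _ (fun w hw => by
      rw [Set.mem_singleton_iff.mp hw]; exact halg)).trans_le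
        (trdeg_adjoin_singleton_le_one (Complex.exp 1)))
  norm_num at this

end Summit.Schanuel.Schanuel.Cruxes.SchanuelOnLogFreeCore.Disproof

end
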